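import Literature.Analysis.FluidPDE.TypeIAncientMild
import Literature.Analysis.FluidPDE.NSBoundedMildAnalytic
import Literature.Analysis.FluidPDE.NSLocalLerayBackwardUniqueness
import Literature.Analysis.FluidPDE.OseenMildUniqueness
import HarnessLib

/-!
# Route `ExtremiserTransience`, crux `NearExtremalTransiencePerFlow` (stmt-NavierStokesRegularity-26567), LINE g9-β
# `filament_selection` §2g — input A `TypeIAncientMildTimeAnalytic`: TYPE-I ANCIENT MILD FIELDS ARE REAL-ANALYTIC IN TIME

Theorems file (`--supports stmt-NavierStokesRegularity-26567`).  `typeIAncientMildTimeAnalytic` is VERBATIM the Prop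
`TypeIAncientMildTimeAnalytic` of the crux workfile `Cruxes/NearExtremalTransiencePerFlow/Lines/filament_selection.lean` (rev 8,
§2g; `E3` unfolded): for every Type-I ancient mild field `W` (Oseen/KNSS gauge, `IsTypeIAncientMild K W`), every `x` and every
`τ < 0`, the time line `σ ↦ W σ x` is real-analytic at `τ`.

Proof = the time twin of the tree's `IsTypeIAncientMild.analyticOnNhd_slice_univ` (Barker–Prange file): Lemarié-Rieusset 2016,
Thm. 9.12 in the tree's PROVED local form `lemarieRieusset2016_local_analyticity_holds` gives, from the bounded slice `W s₁`
(`s₁ < τ`, window length `ε/M²` with `M` a Type-I bound on `(−∞, τ/2]`), a JOINTLY space–time real-analytic Oseen fixed point `v`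
on `(s₁, s₁ + ε/M²) × ℝ³`; uniqueness of bounded Oseen-mild solutions (`oseenMild_bounded_unique`) identifies `v σ = W σ` (a.e.,
then everywhere by continuity) for all `σ` in an open window around `τ`; `σ ↦ (σ, x)` is analytic, so `σ ↦ v σ x` is analytic at
`τ`, and `AnalyticAt.congr` transfers this to `σ ↦ W σ x`.  (Sharper print source, not needed here: Dong–Zhang 2020, Thm 2.)
HONEST FRAMING: a regularity statement about hypothetical blow-up profiles; nothing about Navier–Stokes regularity or blow-up is
proved; no summit is proved by a line. [folklore]
-/

noncomputable section

open MeasureTheory Set Function Filter Topology Metric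
open Literature.Analysis Literature.Analysis.FluidPDE
open scoped ENNReal

namespace Summit.NavierStokesRegularity.NavierStokesRegularity.Theorems.AxiallyPeriodicLiouville
-- the summit's namespace `Summit.NavierStokesRegularity.NavierStokesRegularity` repeats the problem name by convention (D-0017)
set_option linter.dupNamespace false

/-- **Time lines of a Type-I ancient mild field are real-analytic**: for `IsTypeIAncientMild C U`, every `x` and `τ < 0`,
`σ ↦ U σ x` is `AnalyticAt ℝ` at `τ` (Lemarié-Rieusset 2016, Thm. 9.12 via the tree's `lemarieRieusset2016_local_analyticity_holds`
+ `oseenMild_bounded_unique`; the time twin of `IsTypeIAncientMild.analyticOnNhd_slice_univ`). [folklore] -/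
theorem analyticAt_time_of_isTypeIAncientMild {C : ℝ}
    {U : ℝ → EuclideanSpace ℝ (Fin 3) → EuclideanSpace ℝ (Fin 3)} (h : IsTypeIAncientMild C U)
    (x : EuclideanSpace ℝ (Fin 3)) {t : ℝ} (ht : t < 0) :
    AnalyticAt ℝ (fun σ : ℝ => U σ x) t := by
  obtain ⟨ε, hε, C₀, hC₀, hloc⟩ := lemarieRieusset2016_local_analyticity_holds
  have hC : 0 ≤ C := h.nonneg
  -- a uniform bound `B` of `U` on the times `≤ t/2 < 0`
  set B : ℝ := C / Real.sqrt (-(t / 2)) with hB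
  have hB0 : 0 ≤ B := div_nonneg hC (Real.sqrt_nonneg _)
  have hnormle : ∀ τ, τ ≤ t / 2 → ∀ y, ‖U τ y‖ ≤ B := by
    intro τ hτ y
    have hτ0 : τ < 0 := by linarith
    refine (h.norm_le hτ0 y).trans ?_
    exact div_le_div_of_nonneg_left hC (Real.sqrt_pos.2 (by linarith)) (Real.sqrt_le_sqrt (by linarith))
  set Mb : ℝ := B + 1 with hMb
  have hMb0 : 0 < Mb := by rw [hMb]; linarith
  have hlen : 0 < ε * 1 / Mb ^ 2 := by positivity
  -- the initial time of the analytic window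
  set s₁ : ℝ := t - (ε * 1 / Mb ^ 2) / 2 with hs₁
  have hs₁t : s₁ < t := by rw [hs₁]; linarith
  have hs₁0 : s₁ < 0 := by linarith
  have ha_meas : AEStronglyMeasurable (U s₁) volume := (h.continuous_slice hs₁0).aestronglyMeasurable
  have ha_bd : eLpNorm (U s₁) ∞ volume ≤ ENNReal.ofReal Mb := by
    rw [eLpNorm_exponent_top]
    refine eLpNormEssSup_le_of_ae_bound (Eventually.of_forall fun y => ?_)
    exact (hnormle s₁ (by linarith) y).trans (by rw [hMb]; linarith)
  obtain ⟨vl, hvl_an, hvl_eq, hvl_bd⟩ := hloc one_pos s₁ hMb0 ha_meas ha_bd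
  -- the common window `(s₁, T₂)`, `T₂ = min (s₁ + ε/Mb²) (t/2) ∋ t`
  set T₂ : ℝ := min (s₁ + ε * 1 / Mb ^ 2) (t / 2) with hT₂
  have htT₂ : t < T₂ := lt_min (by rw [hs₁]; linarith) (by linarith)
  have hT₂0 : T₂ < 0 := (min_le_right _ _).trans_lt (by linarith)
  have hT₂h : T₂ ≤ s₁ + ε * 1 / Mb ^ 2 := min_le_left _ _
  have hT₂t : T₂ ≤ t / 2 := min_le_right _ _
  -- uniqueness of bounded Oseen-mild solutions on the window
  set M' : ℝ := max B (C₀ * Mb) with hM'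
  have hM'0 : 0 ≤ M' := hB0.trans (le_max_left _ _)
  have hum : AEStronglyMeasurable (uncurry U) (volume.restrict (Ioo s₁ T₂ ×ˢ univ)) :=
    (h.continuousOn_uncurry.mono (prod_mono (fun τ hτ => mem_Iio.2 ((mem_Ioo.1 hτ).2.trans hT₂0))
      Subset.rfl)).aestronglyMeasurable (measurableSet_Ioo.prod MeasurableSet.univ)
  have hvm : AEStronglyMeasurable (uncurry vl) (volume.restrict (Ioo s₁ T₂ ×ˢ univ)) :=
    (hvl_an.continuousOn.mono (prod_mono (Ioo_subset_Ioo_right hT₂h) Subset.rfl)).aestronglyMeasurable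
      (measurableSet_Ioo.prod MeasurableSet.univ)
  have huM : ∀ τ ∈ Ioo s₁ T₂, ∀ y, ‖U τ y‖ ≤ M' := fun τ hτ y =>
    (hnormle τ (hτ.2.le.trans hT₂t) y).trans (le_max_left _ _)
  have hvM : ∀ τ ∈ Ioo s₁ T₂, ∀ y, ‖vl τ y‖ ≤ M' := fun τ hτ y =>
    (hvl_bd τ ⟨hτ.1, hτ.2.trans_le hT₂h⟩ y).trans (le_max_right _ _)
  have hu : ∀ τ ∈ Ioo s₁ T₂, U τ =ᵐ[volume] fun y =>
      UnboundedOperators.heatExtension (U s₁) (1 * (τ - s₁)) y - oseenDuhamel 1 s₁ U U τ y :=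
    fun τ hτ => Eventually.of_forall fun y => by
      rw [one_mul]
      exact h.mild_eq_heatExtension hτ.1 (hτ.2.trans hT₂0) y
  have hv : ∀ τ ∈ Ioo s₁ T₂, vl τ =ᵐ[volume] fun y =>
      UnboundedOperators.heatExtension (U s₁) (1 * (τ - s₁)) y - oseenDuhamel 1 s₁ vl vl τ y :=
    fun τ hτ => Eventually.of_forall fun y => hvl_eq τ ⟨hτ.1, hτ.2.trans_le hT₂h⟩ y
  have heq := oseenMild_bounded_unique
    (U := fun τ y => UnboundedOperators.heatExtension (U s₁) (1 * (τ - s₁)) y)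
    one_pos hM'0 hum hvm huM hvM hu hv
  -- `U σ = vl σ` everywhere on the open window, by continuity of both slices
  have hslice : ∀ σ ∈ Ioo s₁ T₂, U σ = vl σ := by
    intro σ hσ
    have hσ0 : σ < 0 := hσ.2.trans hT₂0
    have hσw : σ ∈ Ioo s₁ (s₁ + ε * 1 / Mb ^ 2) := ⟨hσ.1, hσ.2.trans_le hT₂h⟩
    have hvlc : Continuous (vl σ) := continuousOn_univ.1 (analyticOnNhd_slice hvl_an hσw).continuousOn
    exact (Continuous.ae_eq_iff_eq volume (h.continuous_slice hσ0) hvlc).1 (heq σ hσ)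
  -- the time line of `vl` through `x` is analytic at `t`
  have htwin : t ∈ Ioo s₁ (s₁ + ε * 1 / Mb ^ 2) := ⟨hs₁t, htT₂.trans_le hT₂h⟩
  have hz : AnalyticAt ℝ (uncurry vl) (t, x) := hvl_an (t, x) ⟨htwin, mem_univ _⟩
  have hι : AnalyticAt ℝ (fun σ : ℝ => ((σ, x) : ℝ × EuclideanSpace ℝ (Fin 3))) t := analyticAt_id.prod analyticAt_const
  have hvl_line : AnalyticAt ℝ (fun σ : ℝ => vl σ x) t :=
    AnalyticAt.comp (g := uncurry vl) (f := fun σ : ℝ => ((σ, x) : ℝ × EuclideanSpace ℝ (Fin 3))) (x := t) hz hι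
  -- transfer along the eventual equality of the time lines
  refine hvl_line.congr ?_
  have hopen : IsOpen (Ioo s₁ T₂) := isOpen_Ioo
  filter_upwards [hopen.mem_nhds ⟨hs₁t, htT₂⟩] with σ hσ
  simp only [hslice σ hσ]

/-- **Input A `TypeIAncientMildTimeAnalytic` of LINE g9-β §2g, EXACTLY as typed** (`E3` unfolded): Type-I ancient mild fields have
real-analytic time lines at every `τ < 0`. [folklore] -/
theorem typeIAncientMildTimeAnalytic :
    ∀ (K : ℝ) (W : ℝ → EuclideanSpace ℝ (Fin 3) → EuclideanSpace ℝ (Fin 3)),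
      Literature.Analysis.FluidPDE.IsTypeIAncientMild K W →
      ∀ (x : EuclideanSpace ℝ (Fin 3)) (τ : ℝ), τ < 0 → AnalyticAt ℝ (fun σ : ℝ => W σ x) τ :=
  fun _ _ hW x _ hτ => analyticAt_time_of_isTypeIAncientMild hW x hτ

end Summit.NavierStokesRegularity.NavierStokesRegularity.Theorems.AxiallyPeriodicLiouville

end
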